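import Summits.Ventures.CertifiedQuantumChemistry.Rows.SlaterCondonFastBridge
import HarnessLib

/-!
# Ventures/CertifiedQuantumChemistry — Rows/CIFastRows.lean: kernel-proved CI UPPER rows through the bit-mask
# Slater–Condon evaluator (row loop, sector / norm checks on masks, entry theorems)

HONEST FRAMING (verbatim): certified bounds for a stated model Hamiltonian in a stated basis; not a
claim about the real molecule beyond that model.

var-2 (gen 16), zero compute, PROVED glue only (0 sorry, no claim node; nothing here asserts a bound about any model).
The multi-determinant UPPER certificate of `Rows/CIUpperBound.lean` (typer) / `Rows/CIEnergySymmetric.lean` (var-2 g14)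
is fed here from INTEGER data indexed by `ℕ`: masks `mask i < 4^k` (occupation vectors, `Rows/OccupationVectorMasks.lean`)
in strictly increasing order, integer coefficients `coef i`, integer row bounds `R i`, for `i < n`. The trial vector is
`ciOf k n mask coef = Σ_i coef i · |onv (mask i)⟩` (`Rows/SlaterCondonFast.lean`). Theorems only.

* `FastTables.rowTail_eq_sum`, `fastRow_eq` — the row loop of `Rows/SlaterCondonFast.lean` (row `i` of the upper-triangle
  Rayleigh numerator at scale `2D`, `c_i (c_i·sc(m_i,m_i) + 2 Σ_{j>i, ¬far4} c_j·sc(m_i,m_j))`, far pairs skipped by four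
  GMP `x &&& (x−1)` steps before any evaluation) bridged to the `ℚ` row of `CIVec.energy_le_of_upperRows`.
* sector purity and distinctness read off the masks: `card_upPart_onv` / `card_downPart_onv` (popcounts of the even /
  odd bit positions, the position masks `E`, `O` being instance literals checked bitwise by `decide`),
  `det_injective_of_mask_lt` (strictly increasing masks), `normSq_ciOf` (`⟨ψ,ψ⟩ = Σ c_i²`).
* **ENTRY** `FastTables.upperCertificate_of_fastRows` / `upperRow_of_fastRows`: the agreement hypothesis `hA` of
  `Rows/SlaterCondonFast.lean`, the cheap mask checks, the row inequalities `fastRow i ≤ R i` (proved chunk by chunk with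
  `decide`, `rows_of_chunks` to assemble) and ONE rational comparison `Σ R_i ≤ 2·D·hi·Σ c_i²` give
  `UpperCertificate F a b hi` / `UpperRow F a b hi`.

First use: `Certificates/H8RingSto3gR0707Fast*.lean` (the `(4,4)` sector of the H₈ ring, 1 225-determinant block).
-/

namespace Summit.Ventures.CertifiedQuantumChemistry

open Finset
open Literature.MathematicalPhysics.QuantumLattice Literature.MathematicalPhysics.QuantumChemistry

namespace FastTables

variable {k : ℕ} (T : FastTables)

/-- The inner loop is a sum over `Ico j0 (j0 + fuel)`. -/
theorem rowTail_eq_sum (mask : ℕ → ℕ) (coef : ℕ → ℤ) (m j0 fuel : ℕ) :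
    T.rowTail mask coef m j0 fuel =
      ∑ j ∈ Ico j0 (j0 + fuel), (if far4 (m ^^^ mask j) then 0 else coef j * T.sc m (mask j)) := by
  induction fuel generalizing j0 with
  | zero => simp [rowTail]
  | succ f ih =>
    rw [rowTail, ih (j0 + 1), eq_comm, Finset.sum_eq_sum_Ico_succ_bot (show j0 < j0 + (f + 1) by omega),
      show j0 + (f + 1) = j0 + 1 + f by omega]

section Bridge

variable {T} {F : Model k} {D : ℚ}
variable (hA : T.B = 2 * k ∧ 2 * k ≤ 24 ∧ (∀ p q : Fin k, (T.H p.val q.val : ℚ) = D * F.h p q) ∧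
    (∀ p q r s : Fin k, (T.V p.val q.val r.val s.val : ℚ) = D * F.eri p q r s) ∧ (T.E : ℚ) = 2 * D * F.ecore)
include hA

/-- **Row bridge**: `fastRow i / (2D)` is row `i` of the upper-triangle Rayleigh numerator of `ciOf k n mask coef`. -/
theorem fastRow_eq {n : ℕ} {mask : ℕ → ℕ} (coef : ℕ → ℤ) (hmask : ∀ i < n, mask i < 2 ^ (2 * k)) (i : Fin n) :
    (T.fastRow mask coef n i.val : ℚ) =
      2 * D * ((ciOf k n mask coef).coeff i * (ciOf k n mask coef).coeff i *
          F.slaterCondon ((ciOf k n mask coef).det i) ((ciOf k n mask coef).det i) +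
        2 * ∑ j : Fin n, if i < j then (ciOf k n mask coef).coeff i * (ciOf k n mask coef).coeff j *
          F.slaterCondon ((ciOf k n mask coef).det i) ((ciOf k n mask coef).det j) else 0) := by
  have hi := hmask i.val i.isLt
  unfold fastRow
  rw [rowTail_eq_sum, show i.val + 1 + (n - (i.val + 1)) = n by omega]
  push_cast
  rw [sc_eq hA hi hi]
  -- the tail: every summand is `coef j · 2D · ⟨D_i|H|D_j⟩` (far pairs contribute `0` on both sides)
  have htail : ∀ j ∈ Ico (i.val + 1) n, (if far4 (mask i.val ^^^ mask j) = true then (0 : ℚ)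
      else (coef j : ℚ) * (T.sc (mask i.val) (mask j) : ℚ)) =
      (coef j : ℚ) * (2 * D * F.slaterCondon (Onv.onv k (mask i.val)) (Onv.onv k (mask j))) := by
    intro j hj
    have hjn : j < n := (Finset.mem_Ico.1 hj).2
    split_ifs with hfar
    · rw [slaterCondon_onv_eq_zero_of_far4 F hi (hmask j hjn) hfar]; simp
    · rw [sc_eq hA hi (hmask j hjn)]
  rw [Finset.sum_congr rfl htail]
  -- the `Fin n` sum is the same sum over `Ico (i+1) n`
  have hfin : (∑ j : Fin n, if i < j then (ciOf k n mask coef).coeff i * (ciOf k n mask coef).coeff j *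
      F.slaterCondon ((ciOf k n mask coef).det i) ((ciOf k n mask coef).det j) else 0) =
      ∑ j ∈ Ico (i.val + 1) n, (coef i.val : ℚ) * (coef j : ℚ) *
        F.slaterCondon (Onv.onv k (mask i.val)) (Onv.onv k (mask j)) := by
    have hterm : ∀ j : Fin n, (if i < j then (ciOf k n mask coef).coeff i * (ciOf k n mask coef).coeff j *
        F.slaterCondon ((ciOf k n mask coef).det i) ((ciOf k n mask coef).det j) else 0) =
        (fun j : ℕ => if i.val < j then (coef i.val : ℚ) * (coef j : ℚ) *
          F.slaterCondon (Onv.onv k (mask i.val)) (Onv.onv k (mask j)) else 0) j.val := by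
      intro j
      simp only [ciOf, Fin.lt_def]
    rw [Finset.sum_congr rfl (fun j _ => hterm j), Fin.sum_univ_eq_sum_range (fun j : ℕ => if i.val < j then
      (coef i.val : ℚ) * (coef j : ℚ) * F.slaterCondon (Onv.onv k (mask i.val)) (Onv.onv k (mask j)) else 0) n,
      ← Finset.sum_filter]
    congr 1
    ext j
    simp only [Finset.mem_filter, Finset.mem_range, Finset.mem_Ico]
    omega
  rw [hfin]
  have hs1 : ∑ j ∈ Ico (i.val + 1) n, (coef j : ℚ) *
      (2 * D * F.slaterCondon (Onv.onv k (mask i.val)) (Onv.onv k (mask j))) =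
      2 * D * ∑ j ∈ Ico (i.val + 1) n, (coef j : ℚ) * F.slaterCondon (Onv.onv k (mask i.val)) (Onv.onv k (mask j)) := by
    rw [Finset.mul_sum]; exact Finset.sum_congr rfl fun j _ => by ring
  have hs2 : ∑ j ∈ Ico (i.val + 1) n, (coef i.val : ℚ) * (coef j : ℚ) *
      F.slaterCondon (Onv.onv k (mask i.val)) (Onv.onv k (mask j)) =
      (coef i.val : ℚ) * ∑ j ∈ Ico (i.val + 1) n, (coef j : ℚ) *
        F.slaterCondon (Onv.onv k (mask i.val)) (Onv.onv k (mask j)) := by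
    rw [Finset.mul_sum]; exact Finset.sum_congr rfl fun j _ => by ring
  rw [hs1, hs2]
  simp only [ciOf]
  ring

end Bridge

/-! ## Sector purity and distinctness from the masks -/

/-- `#upPart (onv m)` is the popcount of the even-position bits of `m` (`E` = the even-position mask, checked bitwise). -/
theorem card_upPart_onv (hk : 2 * k ≤ 24) (E : ℕ) (hE24 : E < 2 ^ 24)
    (hE : ∀ q < 24, E.testBit q = decide (q % 2 = 0 ∧ q < 2 * k)) (m : ℕ) :
    (upPart (Onv.onv k m)).card = Onv.pc24 (m &&& E) := by
  have hlt : m &&& E < 2 ^ 24 := Nat.and_lt_two_pow m hE24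
  rw [← Onv.card_bitSet_eq_pc24 hlt]
  rw [← Finset.card_image_of_injective (upPart (Onv.onv k m)) (f := fun p : Fin k => 2 * p.val)
    (fun p q h => Fin.ext (by simpa using h))]
  congr 1
  ext q
  simp only [Finset.mem_image, mem_upPart, Onv.mem_onv, Onv.mem_bitSet, Nat.testBit_and, Bool.and_eq_true]
  constructor
  · rintro ⟨p, hp, rfl⟩
    have hp' := p.isLt
    have hq : 2 * p.val < 24 := by omega
    refine ⟨hq, ?_, ?_⟩
    · simpa [Onv.pos, orb] using hp
    · rw [hE _ hq, decide_eq_true_eq]; omega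
  · rintro ⟨hq, hm, he⟩
    rw [hE q hq, decide_eq_true_eq] at he
    refine ⟨⟨q / 2, by omega⟩, ?_, ?_⟩
    · have : Onv.pos (orb (⟨q / 2, by omega⟩ : Fin k) 0) = q := by simp only [Onv.pos, orb, ofLex_toLex]; omega
      rw [this]; exact hm
    · show 2 * (q / 2) = q
      omega

/-- `#downPart (onv m)` is the popcount of the odd-position bits of `m`. -/
theorem card_downPart_onv (hk : 2 * k ≤ 24) (O : ℕ) (hO24 : O < 2 ^ 24)
    (hO : ∀ q < 24, O.testBit q = decide (q % 2 = 1 ∧ q < 2 * k)) (m : ℕ) :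
    (downPart (Onv.onv k m)).card = Onv.pc24 (m &&& O) := by
  have hlt : m &&& O < 2 ^ 24 := Nat.and_lt_two_pow m hO24
  rw [← Onv.card_bitSet_eq_pc24 hlt]
  rw [← Finset.card_image_of_injective (downPart (Onv.onv k m)) (f := fun p : Fin k => 2 * p.val + 1)
    (fun p q h => Fin.ext (by simpa using h))]
  congr 1
  ext q
  simp only [Finset.mem_image, mem_downPart, Onv.mem_onv, Onv.mem_bitSet, Nat.testBit_and, Bool.and_eq_true]
  constructor
  · rintro ⟨p, hp, rfl⟩
    have hp' := p.isLt
    have hq : 2 * p.val + 1 < 24 := by omega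
    refine ⟨hq, ?_, ?_⟩
    · simpa [Onv.pos, orb] using hp
    · rw [hO _ hq, decide_eq_true_eq]; omega
  · rintro ⟨hq, hm, ho⟩
    rw [hO q hq, decide_eq_true_eq] at ho
    refine ⟨⟨q / 2, by omega⟩, ?_, ?_⟩
    · have : Onv.pos (orb (⟨q / 2, by omega⟩ : Fin k) 1) = q := by simp only [Onv.pos, orb, ofLex_toLex]; omega
      rw [this]; exact hm
    · show 2 * (q / 2) + 1 = q
      omega

/-- Sector purity of `ciOf` from the two popcount checks. -/
theorem inSector_ciOf (hk : 2 * k ≤ 24) {n : ℕ} {mask : ℕ → ℕ} (coef : ℕ → ℤ) (E O : ℕ) (hE24 : E < 2 ^ 24)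
    (hE : ∀ q < 24, E.testBit q = decide (q % 2 = 0 ∧ q < 2 * k)) (hO24 : O < 2 ^ 24)
    (hO : ∀ q < 24, O.testBit q = decide (q % 2 = 1 ∧ q < 2 * k)) {a b : ℕ}
    (hsec : ∀ i < n, Onv.pc24 (mask i &&& E) = a ∧ Onv.pc24 (mask i &&& O) = b) :
    (ciOf k n mask coef).InSector a b := by
  intro i
  obtain ⟨ha, hb⟩ := hsec i.val i.isLt
  exact ⟨(card_upPart_onv hk E hE24 hE _).trans ha, (card_downPart_onv hk O hO24 hO _).trans hb⟩

/-- Strictly increasing masks below `2^(2k)` give pairwise distinct determinants. -/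
theorem det_injective_of_mask_lt {n : ℕ} {mask : ℕ → ℕ} (coef : ℕ → ℤ) (hmask : ∀ i < n, mask i < 2 ^ (2 * k))
    (hmono : ∀ i < n, i + 1 < n → mask i < mask (i + 1)) : Function.Injective (ciOf k n mask coef).det := by
  have hchain : ∀ i j, i < j → j < n → mask i < mask j := by
    intro i j hij hjn
    induction j with
    | zero => omega
    | succ j ih =>
      rcases Nat.lt_succ_iff_lt_or_eq.1 hij with h | rfl
      · exact (ih h (by omega)).trans (hmono j (by omega) hjn)
      · exact hmono i (by omega) hjn
  intro i j h
  simp only [ciOf] at h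
  have heq := Onv.eq_of_onv_eq (hmask i.val i.isLt) (hmask j.val j.isLt) h
  by_contra hne
  rcases lt_or_gt_of_ne (fun e => hne (Fin.ext e)) with hlt | hlt
  · exact absurd heq (hchain _ _ hlt j.isLt).ne
  · exact absurd heq (hchain _ _ hlt i.isLt).ne'

/-- `⟨ψ,ψ⟩ = Σ_i c_i²` for `ciOf` with strictly increasing masks. -/
theorem normSq_ciOf {n : ℕ} {mask : ℕ → ℕ} (coef : ℕ → ℤ) (hmask : ∀ i < n, mask i < 2 ^ (2 * k))
    (hmono : ∀ i < n, i + 1 < n → mask i < mask (i + 1)) :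
    (ciOf k n mask coef).normSq = ((∑ i ∈ range n, coef i * coef i : ℤ) : ℚ) := by
  rw [CIVec.normSq_eq_sum_sq_of_injective _ (det_injective_of_mask_lt coef hmask hmono), Int.cast_sum,
    ← Fin.sum_univ_eq_sum_range (fun i => ((coef i * coef i : ℤ) : ℚ)) n]
  simp [ciOf]

/-- Assemble row chunks: rows `< m` and rows in `[m, n)` give all rows `< n`. -/
theorem rows_of_chunks {P : ℕ → Prop} {m n : ℕ} (h1 : ∀ i < m, P i) (h2 : ∀ i < n, m ≤ i → P i) :
    ∀ i < n, P i := fun i hi => if h : i < m then h1 i h else h2 i hi (not_lt.1 h)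

/-! ## Entry theorems -/

section Entry

variable {T} {F : Model k} {D : ℚ}

/-- **KERNEL ENTRY POINT (certificate form).** Tables agreeing with `F` at scale `D > 0`; masks below `4^k`, strictly
increasing, all in sector `(a, b)` (popcounts); `0 < Σ c_i²`; the fast row inequalities `fastRow i ≤ R i`; and
`Σ R_i ≤ 2·D·hi·Σ c_i²` — give `UpperCertificate F a b hi`. Every hypothesis is a decidable statement on literals. -/
theorem upperCertificate_of_fastRows
    (hA : T.B = 2 * k ∧ 2 * k ≤ 24 ∧ (∀ p q : Fin k, (T.H p.val q.val : ℚ) = D * F.h p q) ∧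
      (∀ p q r s : Fin k, (T.V p.val q.val r.val s.val : ℚ) = D * F.eri p q r s) ∧ (T.E : ℚ) = 2 * D * F.ecore)
    (hF : F.IsSymmetric) (hD : 0 < D) (n : ℕ) (mask : ℕ → ℕ) (coef R : ℕ → ℤ) (E O : ℕ) (hE24 : E < 2 ^ 24)
    (hE : ∀ q < 24, E.testBit q = decide (q % 2 = 0 ∧ q < 2 * k)) (hO24 : O < 2 ^ 24)
    (hO : ∀ q < 24, O.testBit q = decide (q % 2 = 1 ∧ q < 2 * k)) {a b : ℕ} {hi : ℚ}
    (hmask : ∀ i < n, mask i < 2 ^ (2 * k)) (hmono : ∀ i < n, i + 1 < n → mask i < mask (i + 1))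
    (hsec : ∀ i < n, Onv.pc24 (mask i &&& E) = a ∧ Onv.pc24 (mask i &&& O) = b)
    (hpos : 0 < ∑ i ∈ range n, coef i * coef i) (hrow : ∀ i < n, T.fastRow mask coef n i ≤ R i)
    (hsum : ((∑ i ∈ range n, R i : ℤ) : ℚ) ≤ 2 * D * hi * ((∑ i ∈ range n, coef i * coef i : ℤ) : ℚ)) :
    UpperCertificate F a b hi := by
  have hnorm := normSq_ciOf (k := k) coef hmask hmono
  have h2D : (0 : ℚ) < 2 * D := by linarith
  refine CIVec.upperCertificate_of_upperRows hF (ciOf k n mask coef) (fun i => (R i.val : ℚ) / (2 * D))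
    (inSector_ciOf hA.2.1 coef E O hE24 hE hO24 hO hsec) ?_ ?_ ?_
  · rw [hnorm]; exact_mod_cast hpos
  · intro i
    have e := fastRow_eq hA coef hmask i
    rw [le_div_iff₀ h2D, mul_comm, ← e]
    exact_mod_cast hrow i.val i.isLt
  · rw [← Finset.sum_div, div_le_iff₀ h2D, hnorm, ← Int.cast_sum,
      Fin.sum_univ_eq_sum_range (fun i => R i) n]
    calc ((∑ i ∈ range n, R i : ℤ) : ℚ) ≤ 2 * D * hi * ((∑ i ∈ range n, coef i * coef i : ℤ) : ℚ) := hsum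
      _ = hi * ((∑ i ∈ range n, coef i * coef i : ℤ) : ℚ) * (2 * D) := by ring

/-- **KERNEL ENTRY POINT (row form)**: the same data give `UpperRow F a b hi` (Rayleigh–Ritz in the sector). -/
theorem upperRow_of_fastRows
    (hA : T.B = 2 * k ∧ 2 * k ≤ 24 ∧ (∀ p q : Fin k, (T.H p.val q.val : ℚ) = D * F.h p q) ∧
      (∀ p q r s : Fin k, (T.V p.val q.val r.val s.val : ℚ) = D * F.eri p q r s) ∧ (T.E : ℚ) = 2 * D * F.ecore)
    (hF : F.IsSymmetric) (hD : 0 < D) (n : ℕ) (mask : ℕ → ℕ) (coef R : ℕ → ℤ) (E O : ℕ) (hE24 : E < 2 ^ 24)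
    (hE : ∀ q < 24, E.testBit q = decide (q % 2 = 0 ∧ q < 2 * k)) (hO24 : O < 2 ^ 24)
    (hO : ∀ q < 24, O.testBit q = decide (q % 2 = 1 ∧ q < 2 * k)) {a b : ℕ} {hi : ℚ}
    (hmask : ∀ i < n, mask i < 2 ^ (2 * k)) (hmono : ∀ i < n, i + 1 < n → mask i < mask (i + 1))
    (hsec : ∀ i < n, Onv.pc24 (mask i &&& E) = a ∧ Onv.pc24 (mask i &&& O) = b)
    (hpos : 0 < ∑ i ∈ range n, coef i * coef i) (hrow : ∀ i < n, T.fastRow mask coef n i ≤ R i)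
    (hsum : ((∑ i ∈ range n, R i : ℤ) : ℚ) ≤ 2 * D * hi * ((∑ i ∈ range n, coef i * coef i : ℤ) : ℚ)) :
    UpperRow F a b hi :=
  upperRow_of_certificate hF
    (upperCertificate_of_fastRows hA hF hD n mask coef R E O hE24 hE hO24 hO hmask hmono hsec hpos hrow hsum)

end Entry

end FastTables

end Summit.Ventures.CertifiedQuantumChemistry
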